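import Summits.Ventures.HSemireg.WedgeHankelClassSpaceSl2Triple
import Summits.Ventures.HSemireg.WedgeHankelSubstitutionSemisimpleCentralizer

/-!
# Venture HSemireg — THE WEIGHT DECOMPOSITION OF TH-7's CLASS SPACE: th-7's spikes are an eigenbasis of the weight operator `h` (`h E_i = (2i − n) E_i`), so
# `eigenspace(h, m) = span{E_i : 2i − n = m}`, `dim = #{i : 2i − n = m}`; when the weights `2i − n` are distinct in `K` (e.g. characteristic `0`) every weight space is a line
# `K·E_i`, `h` has `n + 1` eigenvalues, and `dim Centralizer(h) = n + 1` (the diagonal algebra, as for th-7's torus)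

HONEST FRAMING. Part of the Lean index of the computation cell `pub-hsemireg` (seat p10 gen 22, Sunday typer «UNIFORM-IN-n»).
Finite-dimensional EXTERIOR ALGEBRA + linear algebra ONLY: no variety, no cohomology theory, no sheaf, no Ext group, no semiregularity map;
nothing here says that HC / HC_CM / HC_AV holds; no Literature fact is declared or used.  Custodian versions as in `WedgeHankelSiegelIdeal` (1/3) and `WedgeHankelFrameChange`;
the dictionary (the weight-space decomposition of `Sym^n` under the Cartan element) is QUOTED, never asserted.

WHAT IS IN THE TREE.  K27 (`WedgeHankelClassSpaceSl2Triple`): the weight operator `h` given on the spikes (`hH`), `commute_SbC_diag_weight`; K18 (`…SemisimpleEigenspaces`):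
`eigenspace_eq_span_of_eigenbasis`, `finrank_eigenspace_of_eigenbasis`, `hasEigenvalue_iff_of_eigenbasis`; K23 (`…SemisimpleCentralizer`): `finrank_centralizer_of_eigenbasis_eq_sum_card`,
`finrank_centralizer_of_eigenbasis_of_injective`.  THIS FILE (namespace `Summit.Ventures.HSemireg.Wedge.HankelFrameChange` continued; imports K27, K23):
* §350 **`eigenspace_weight_eq_span`** (`eigenspace(h, m) = span{E_i : 2i − n = m}`), **`finrank_eigenspace_weight`** (`= #{i : 2i − n = m}`), `hasEigenvalue_weight_iff`,
  `spikeBasis_mem_eigenspace_weight`, **`eigenspace_weight_eq_span_singleton`** (distinct weights: `eigenspace(h, 2i − n) = K·E_i`), `finrank_eigenspace_weight_eq_one`,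
  `weights_injective_of_charZero` (`2i − n`, `i ≤ n`, are distinct in characteristic `0`), `iSup_eigenspace_weight_eq_top` (`h` is diagonalisable).
* §351 **`finrank_centralizer_weight`** (`dim Centralizer(h) = Σ_i #{j : 2j − n = 2i − n}`), **`finrank_centralizer_weight_of_injective`** (distinct weights: `n + 1`),
  `finrank_centralizer_weight_charZero`.
NOT typed here: characteristic `2` (then `h = −n·1` is a scalar), the joint weight spaces of `h` and the torus; anything Ext-side.  New names only.
-/

open Module

namespace Summit.Ventures.HSemireg.Wedge.HankelFrameChange

open Summit.Ventures.HSemireg.Wedge Summit.Ventures.HSemireg.Wedge.Kunneth Summit.Ventures.HSemireg.Wedge.Hankel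
  Summit.Ventures.HSemireg.Wedge.BasisFree Summit.Ventures.HSemireg.Wedge.HankelSiegel Summit.Ventures.HSemireg.Wedge.HankelSiegelIdeal
  Summit.Ventures.HSemireg.Wedge.KunnethKernel Summit.Ventures.HSemireg.Wedge.HankelRankOne Summit.Ventures.HSemireg.Wedge.KernelDuality

variable (K : Type*) [Field K] {n : ℕ}

section Weight

variable {h : Module.End K (spikeSpan K n)} (hH : ∀ i : Fin (n + 1), h (spikeBasis K n i) = (2 * ((i : ℕ) : K) - n) • spikeBasis K n i)
include hH

/-! ## §350. The weight spaces -/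

/-- **`eigenspace(h, m) = span{E_i : 2i − n = m}`** (th-7's spikes are an eigenbasis of the weight operator). -/
theorem eigenspace_weight_eq_span (m : K) :
    Module.End.eigenspace h m = Submodule.span K (Set.range fun i : {i : Fin (n + 1) // 2 * ((i : ℕ) : K) - n = m} => spikeBasis K n i) :=
  eigenspace_eq_span_of_eigenbasis K h (spikeBasis K n) (fun i : Fin (n + 1) => 2 * ((i : ℕ) : K) - n) hH m

open Classical in
/-- **`dim eigenspace(h, m) = #{i ≤ n : 2i − n = m in K}`.** -/
theorem finrank_eigenspace_weight (m : K) :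
    finrank K ↥(Module.End.eigenspace h m) = (Finset.univ.filter fun i : Fin (n + 1) => 2 * ((i : ℕ) : K) - n = m).card :=
  finrank_eigenspace_of_eigenbasis K h (spikeBasis K n) _ hH m

/-- the eigenvalues of `h` are exactly the weights `2i − n`. -/
theorem hasEigenvalue_weight_iff (m : K) : Module.End.HasEigenvalue h m ↔ ∃ i : Fin (n + 1), 2 * ((i : ℕ) : K) - n = m :=
  hasEigenvalue_iff_of_eigenbasis K h (spikeBasis K n) _ hH m

/-- `E_i ∈ eigenspace(h, 2i − n)`. -/
theorem spikeBasis_mem_eigenspace_weight (i : Fin (n + 1)) : spikeBasis K n i ∈ Module.End.eigenspace h (2 * ((i : ℕ) : K) - n) :=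
  Module.End.mem_eigenspace_iff.mpr (hH i)

/-- **DISTINCT WEIGHTS: `eigenspace(h, 2i − n) = K·E_i`** — every weight space is a line. -/
theorem eigenspace_weight_eq_span_singleton (hinj : Function.Injective fun i : Fin (n + 1) => 2 * ((i : ℕ) : K) - n) (i : Fin (n + 1)) :
    Module.End.eigenspace h (2 * ((i : ℕ) : K) - n) = K ∙ spikeBasis K n i := by
  rw [eigenspace_weight_eq_span K hH]
  apply le_antisymm
  · rw [Submodule.span_le]
    rintro _ ⟨⟨j, hj⟩, rfl⟩
    have hji : j = i := hinj hj
    subst hji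
    exact Submodule.mem_span_singleton_self _
  · rw [Submodule.span_singleton_le_iff_mem]
    exact Submodule.subset_span ⟨⟨i, rfl⟩, rfl⟩

open Classical in
/-- distinct weights: every weight space has dimension `1`. -/
theorem finrank_eigenspace_weight_eq_one (hinj : Function.Injective fun i : Fin (n + 1) => 2 * ((i : ℕ) : K) - n) (i : Fin (n + 1)) :
    finrank K ↥(Module.End.eigenspace h (2 * ((i : ℕ) : K) - n)) = 1 := by
  rw [eigenspace_weight_eq_span_singleton K hH hinj i, finrank_span_singleton ((spikeBasis K n).ne_zero i)]

omit hH in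
/-- **in characteristic `0` the weights `2i − n`, `i ≤ n`, are pairwise distinct.** -/
theorem weights_injective_of_charZero [CharZero K] : Function.Injective fun i : Fin (n + 1) => 2 * ((i : ℕ) : K) - n := by
  intro i j hij
  have h2 : (2 : K) * ((i : ℕ) : K) = 2 * ((j : ℕ) : K) := sub_left_injective hij
  have h3 : ((i : ℕ) : K) = ((j : ℕ) : K) := mul_left_cancel₀ two_ne_zero h2
  exact Fin.ext (Nat.cast_injective h3)

/-- `h` is diagonalisable: `⨆_m eigenspace(h, m) = ⊤`. -/
theorem iSup_eigenspace_weight_eq_top : ⨆ m : K, Module.End.eigenspace h m = ⊤ := by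
  rw [eq_top_iff, ← (spikeBasis K n).span_eq, Submodule.span_le]
  rintro _ ⟨i, rfl⟩
  exact Submodule.mem_iSup_of_mem _ (spikeBasis_mem_eigenspace_weight K hH i)

/-! ## §351. The centralizer of the weight operator -/

open Classical in
/-- **`dim Centralizer(h) = Σ_i #{j ≤ n : 2j − n = 2i − n in K}`** (K23's count for an endomorphism with an eigenbasis). -/
theorem finrank_centralizer_weight :
    finrank K ↥(Subalgebra.centralizer K ({h} : Set (Module.End K (spikeSpan K n)))) =
      ∑ i : Fin (n + 1), (Finset.univ.filter fun j : Fin (n + 1) => 2 * ((j : ℕ) : K) - n = 2 * ((i : ℕ) : K) - n).card :=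
  finrank_centralizer_of_eigenbasis_eq_sum_card K h (spikeBasis K n) _ hH

/-- **DISTINCT WEIGHTS: `dim Centralizer(h) = n + 1`** — the endomorphisms diagonal in th-7's spikes, exactly as for the torus with distinct powers (K23). -/
theorem finrank_centralizer_weight_of_injective (hinj : Function.Injective fun i : Fin (n + 1) => 2 * ((i : ℕ) : K) - n) :
    finrank K ↥(Subalgebra.centralizer K ({h} : Set (Module.End K (spikeSpan K n)))) = n + 1 := by
  rw [finrank_centralizer_of_eigenbasis_of_injective K h (spikeBasis K n) _ hH hinj, Fintype.card_fin]

/-- characteristic `0`: `dim Centralizer(h) = n + 1`. -/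
theorem finrank_centralizer_weight_charZero [CharZero K] : finrank K ↥(Subalgebra.centralizer K ({h} : Set (Module.End K (spikeSpan K n)))) = n + 1 :=
  finrank_centralizer_weight_of_injective K hH (weights_injective_of_charZero K)

end Weight

end Summit.Ventures.HSemireg.Wedge.HankelFrameChange
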